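/-
COR-CM (cell pub-hodgecm2, stage 2 of the Hodge ladder) — count-neutral, degree 16, type ℤ/16: the DICTIONARY FROM ONE GENERATOR
(seat prover-pub-hodgecm2-b23-g35-0, binder prover b23, gen 35→; claim DEG16-CYCLIC; sequel of
`Census/HexadecicFaceTransportCyclicAut.lean` and `CorCM/FaceCensusGroupDictionary.lean`). Theorems only:
`zmod_sixteen_involution`, `exists_autEnum_of_generator` (ε from ONE generator of `Aut(K)` + `finrank ℚ K = 16`; complex
conjugation = `g ^ 8` derived), the six base-type readings `mem_T_iff` and the six non-vacuity lemmas
`exists_face_of_generator_T`. No definition, no named fact; `Interfaces.lean` (C1), every E term, B01 and `Transposition/*`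
untouched. HONEST FRAMING: `HC_CM` is NOT proved; nothing here is a headline. T5: n/a-class (dictionary lemmas; no period
binders).
-/
import Summits.HodgeConjecture.CorCM.FaceCensusGroupDictionary
import Summits.HodgeConjecture.CorCM.Census.HexadecicFaceTransportCyclicAut
import HarnessLib

/-!
# Degree 16, cyclic type `ℤ/16`: the dictionary from one generator (enumeration, base types, faces)
-/

noncomputable section

open CategoryTheory NumberField NumberField.ComplexEmbedding
open Literature.AlgebraicGeometry Literature.AlgebraicGeometry.Motives Literature.AlgebraicGeometry.HodgeTheory
open Literature.AlgebraicGeometry.ComplexMultiplication Literature.AlgebraicGeometry.Milne1999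
open Literature.NumberTheory.Automorphic
open Literature.NumberTheory.Automorphic.PicardCM
open Summit.HodgeConjecture.CorCM.Domination

namespace Summit.HodgeConjecture.CorCM.HexadecicFaceTransport.Cyclic

open Summit.HodgeConjecture.CorCM.Census.FaceSquaresModel (mem)
open Summit.HodgeConjecture.CorCM.Census.HexadecicFaceGeneratorsCyclic (Γ enum group_spec)

/-- `ZMod 16`: the only non-zero element killed by `2` is `7`. [folklore] -/
theorem zmod_sixteen_involution : ∀ x : ZMod 16, x ≠ 0 → x + x = 0 → x = 8 := by decide

/-- **The dictionary from ONE generator, type `ℤ/16` (cyclic, degree 16; `c = 8`).**  `K` a Galois CM field of degree `16` whose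
Galois group is generated by `g`; `σ₀` any base embedding.  Then there is an enumeration `ε : Aut(K) ≃ Fin 16`, multiplicative for the
census table, reading `g ^ k ↦ k`, under which THE automorphism inducing complex conjugation at `σ₀` reads `Γ.conj = 8` — proved, not
assumed: it is the unique involution `g ^ 8` (`FaceCensus.exists_enum_of_generator`, `zmod_sixteen_involution`). [folklore] -/
theorem exists_autEnum_of_generator (K : CMField) [IsGalois ℚ K] (hK : Module.finrank ℚ (K : Type) = 16)
    {g : ((K : Type) ≃ₐ[ℚ] (K : Type))} (hg : ∀ x, x ∈ Subgroup.zpowers g) (σ₀ : (K : Type) →+* ℂ) :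
    ∃ ε : ((K : Type) ≃ₐ[ℚ] (K : Type)) ≃ Fin 16,
      (∀ x y : ((K : Type) ≃ₐ[ℚ] (K : Type)), ε (x * y) = Γ.mul (ε x) (ε y)) ∧ (∀ k : Fin 16, ε (g ^ (k : ℕ)) = k) ∧
      ∀ c : ((K : Type) ≃ₐ[ℚ] (K : Type)), σ₀.comp (c : (K : Type) →+* (K : Type)) = conjugate σ₀ → ε c = Γ.conj := by
  have hn : Nat.card ((K : Type) ≃ₐ[ℚ] (K : Type)) = 16 := (IsGalois.card_aut_eq_finrank ℚ (K : Type)).trans hK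
  obtain ⟨ε, hε, hread, hinv⟩ := FaceCensus.exists_enum_of_generator Γ enum group_spec.2.1 group_spec.2.2.1 hg hn
  refine ⟨ε, hε, fun k => FaceCensus.enum_pow_eq ε hread k, fun c hc => group_spec.2.2.1 ?_⟩
  obtain ⟨h0, h2⟩ := hinv c (FaceCensus.conjAut_mul_self σ₀ hc) (FaceCensus.conjAut_ne_one σ₀ hc)
  rw [group_spec.2.2.2]
  exact zmod_sixteen_involution _ h0 h2

/-- The base type of code `255` is the «`g`-interval» `{k | k < 8}`. [folklore] -/
theorem mem_255_iff : ∀ k : Fin 16, mem k 255 = true ↔ (k : ℕ) < 8 := by decide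

/-- The base type of code `765` is the exponent set `{0,2,3,4,5,6,7,9}`. [folklore] -/
theorem mem_765_iff : ∀ k : Fin 16, mem k 765 = true ↔ k ∈ ({0, 2, 3, 4, 5, 6, 7, 9} : Finset (Fin 16)) := by decide

/-- The base type of code `1275` is the exponent set `{0,1,3,4,5,6,7,10}`. [folklore] -/
theorem mem_1275_iff : ∀ k : Fin 16, mem k 1275 = true ↔ k ∈ ({0, 1, 3, 4, 5, 6, 7, 10} : Finset (Fin 16)) := by decide

/-- The base type of code `2295` is the exponent set `{0,1,2,4,5,6,7,11}`. [folklore] -/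
theorem mem_2295_iff : ∀ k : Fin 16, mem k 2295 = true ↔ k ∈ ({0, 1, 2, 4, 5, 6, 7, 11} : Finset (Fin 16)) := by decide

/-- The base type of code `2805` is the exponent set `{0,2,4,5,6,7,9,11}`. [folklore] -/
theorem mem_2805_iff : ∀ k : Fin 16, mem k 2805 = true ↔ k ∈ ({0, 2, 4, 5, 6, 7, 9, 11} : Finset (Fin 16)) := by decide

/-- The base type of code `4845` is the exponent set `{0,2,3,5,6,7,9,12}`. [folklore] -/
theorem mem_4845_iff : ∀ k : Fin 16, mem k 4845 = true ↔ k ∈ ({0, 2, 3, 5, 6, 7, 9, 12} : Finset (Fin 16)) := by decide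

/-- **Faces on the type of code `255` exist (non-vacuity), type `ℤ/16`.**  For `K`, `g`, `σ₀` as above there is a CM type `Φ₀` of `K`
reading as the «`g`-interval» `{k | k < 8}` — `σ₀ ∘ g ^ k ∈ Φ₀ ↔` that condition on `k` (`0 ≤ k < 16`) — and for any two exponents `a, b` at different
places (`b ≠ a`, `b ≠ a + 8`) a rank-four face `(Φ₀; σ₀ ∘ g ^ a, σ₀ ∘ g ^ b)` with exactly these place representatives. [folklore] -/
theorem exists_face_of_generator_255 (K : CMField) [IsGalois ℚ K] (hK : Module.finrank ℚ (K : Type) = 16)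
    {g : ((K : Type) ≃ₐ[ℚ] (K : Type))} (hg : ∀ x, x ∈ Subgroup.zpowers g) (σ₀ : (K : Type) →+* ℂ) (a b : Fin 16)
    (hab : a ≠ b ∧ Γ.mul Γ.conj a ≠ b) :
    ∃ R : Face K, (∀ k : Fin 16, σ₀.comp ((g ^ (k : ℕ) : ((K : Type) ≃ₐ[ℚ] (K : Type))) : (K : Type) →+* (K : Type)) ∈ R.Φ.1 ↔ (k : ℕ) < 8) ∧
      R.p = σ₀.comp ((g ^ (a : ℕ) : ((K : Type) ≃ₐ[ℚ] (K : Type))) : (K : Type) →+* (K : Type)) ∧ R.p' = σ₀.comp ((g ^ (b : ℕ) : ((K : Type) ≃ₐ[ℚ] (K : Type))) : (K : Type) →+* (K : Type)) := by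
  obtain ⟨ε, hε, hpow, hconj⟩ := exists_autEnum_of_generator K hK hg σ₀
  obtain ⟨c, hc⟩ := FaceCensus.exists_conjAut σ₀
  obtain ⟨e, hmul, he⟩ := FaceCensus.exists_enum_of_autEnum Γ σ₀ ε hε
  have hconj' : e conjT = Γ.conj := by rw [FaceCensus.conjT_eq_translate σ₀, ← hc, he, hconj c hc]
  obtain ⟨R₀, hT₀, -, -⟩ := FaceCensus.exists_face_reads Γ e hmul hconj' σ₀ (r := (255, 257, 8224))
    (FaceCensus.mem_faces_of_isFaceB Γ (by decide +kernel))
  have hne : InfinitePlace.mk (σ₀.comp ((g ^ (a : ℕ) : ((K : Type) ≃ₐ[ℚ] (K : Type))) : (K : Type) →+* (K : Type))) ≠ InfinitePlace.mk (σ₀.comp ((g ^ (b : ℕ) : ((K : Type) ≃ₐ[ℚ] (K : Type))) : (K : Type) →+* (K : Type))) := by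
    rw [Ne, FaceCensus.mk_comp_eq_mk_comp_iff σ₀ hc]
    rintro (h | h)
    · exact hab.1 (by rw [← hpow a, ← hpow b, h])
    · exact hab.2 (by rw [← hpow a, ← hpow b, ← h, hε, hconj c hc])
  refine ⟨⟨R₀.Φ, _, _, hne⟩, fun k => ?_, rfl, rfl⟩
  have hk := hT₀.2 (e (translate σ₀ (σ₀.comp ((g ^ (k : ℕ) : ((K : Type) ≃ₐ[ℚ] (K : Type))) : (K : Type) →+* (K : Type)))))
  rw [e.symm_apply_apply, mem_pullType, translate_apply_self, he, hpow] at hk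
  exact hk.symm.trans (mem_255_iff k)

/-- **Faces on the type of code `765` exist (non-vacuity), type `ℤ/16`.**  For `K`, `g`, `σ₀` as above there is a CM type `Φ₀` of `K`
reading as the exponent set `{0,2,3,4,5,6,7,9}` — `σ₀ ∘ g ^ k ∈ Φ₀ ↔` that condition on `k` (`0 ≤ k < 16`) — and for any two exponents `a, b` at different
places (`b ≠ a`, `b ≠ a + 8`) a rank-four face `(Φ₀; σ₀ ∘ g ^ a, σ₀ ∘ g ^ b)` with exactly these place representatives. [folklore] -/
theorem exists_face_of_generator_765 (K : CMField) [IsGalois ℚ K] (hK : Module.finrank ℚ (K : Type) = 16)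
    {g : ((K : Type) ≃ₐ[ℚ] (K : Type))} (hg : ∀ x, x ∈ Subgroup.zpowers g) (σ₀ : (K : Type) →+* ℂ) (a b : Fin 16)
    (hab : a ≠ b ∧ Γ.mul Γ.conj a ≠ b) :
    ∃ R : Face K, (∀ k : Fin 16, σ₀.comp ((g ^ (k : ℕ) : ((K : Type) ≃ₐ[ℚ] (K : Type))) : (K : Type) →+* (K : Type)) ∈ R.Φ.1 ↔ k ∈ ({0, 2, 3, 4, 5, 6, 7, 9} : Finset (Fin 16))) ∧
      R.p = σ₀.comp ((g ^ (a : ℕ) : ((K : Type) ≃ₐ[ℚ] (K : Type))) : (K : Type) →+* (K : Type)) ∧ R.p' = σ₀.comp ((g ^ (b : ℕ) : ((K : Type) ≃ₐ[ℚ] (K : Type))) : (K : Type) →+* (K : Type)) := by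
  obtain ⟨ε, hε, hpow, hconj⟩ := exists_autEnum_of_generator K hK hg σ₀
  obtain ⟨c, hc⟩ := FaceCensus.exists_conjAut σ₀
  obtain ⟨e, hmul, he⟩ := FaceCensus.exists_enum_of_autEnum Γ σ₀ ε hε
  have hconj' : e conjT = Γ.conj := by rw [FaceCensus.conjT_eq_translate σ₀, ← hc, he, hconj c hc]
  obtain ⟨R₀, hT₀, -, -⟩ := FaceCensus.exists_face_reads Γ e hmul hconj' σ₀ (r := (765, 1028, 4112))
    (FaceCensus.mem_faces_of_isFaceB Γ (by decide +kernel))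
  have hne : InfinitePlace.mk (σ₀.comp ((g ^ (a : ℕ) : ((K : Type) ≃ₐ[ℚ] (K : Type))) : (K : Type) →+* (K : Type))) ≠ InfinitePlace.mk (σ₀.comp ((g ^ (b : ℕ) : ((K : Type) ≃ₐ[ℚ] (K : Type))) : (K : Type) →+* (K : Type))) := by
    rw [Ne, FaceCensus.mk_comp_eq_mk_comp_iff σ₀ hc]
    rintro (h | h)
    · exact hab.1 (by rw [← hpow a, ← hpow b, h])
    · exact hab.2 (by rw [← hpow a, ← hpow b, ← h, hε, hconj c hc])
  refine ⟨⟨R₀.Φ, _, _, hne⟩, fun k => ?_, rfl, rfl⟩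
  have hk := hT₀.2 (e (translate σ₀ (σ₀.comp ((g ^ (k : ℕ) : ((K : Type) ≃ₐ[ℚ] (K : Type))) : (K : Type) →+* (K : Type)))))
  rw [e.symm_apply_apply, mem_pullType, translate_apply_self, he, hpow] at hk
  exact hk.symm.trans (mem_765_iff k)

/-- **Faces on the type of code `1275` exist (non-vacuity), type `ℤ/16`.**  For `K`, `g`, `σ₀` as above there is a CM type `Φ₀` of `K`
reading as the exponent set `{0,1,3,4,5,6,7,10}` — `σ₀ ∘ g ^ k ∈ Φ₀ ↔` that condition on `k` (`0 ≤ k < 16`) — and for any two exponents `a, b` at different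
places (`b ≠ a`, `b ≠ a + 8`) a rank-four face `(Φ₀; σ₀ ∘ g ^ a, σ₀ ∘ g ^ b)` with exactly these place representatives. [folklore] -/
theorem exists_face_of_generator_1275 (K : CMField) [IsGalois ℚ K] (hK : Module.finrank ℚ (K : Type) = 16)
    {g : ((K : Type) ≃ₐ[ℚ] (K : Type))} (hg : ∀ x, x ∈ Subgroup.zpowers g) (σ₀ : (K : Type) →+* ℂ) (a b : Fin 16)
    (hab : a ≠ b ∧ Γ.mul Γ.conj a ≠ b) :
    ∃ R : Face K, (∀ k : Fin 16, σ₀.comp ((g ^ (k : ℕ) : ((K : Type) ≃ₐ[ℚ] (K : Type))) : (K : Type) →+* (K : Type)) ∈ R.Φ.1 ↔ k ∈ ({0, 1, 3, 4, 5, 6, 7, 10} : Finset (Fin 16))) ∧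
      R.p = σ₀.comp ((g ^ (a : ℕ) : ((K : Type) ≃ₐ[ℚ] (K : Type))) : (K : Type) →+* (K : Type)) ∧ R.p' = σ₀.comp ((g ^ (b : ℕ) : ((K : Type) ≃ₐ[ℚ] (K : Type))) : (K : Type) →+* (K : Type)) := by
  obtain ⟨ε, hε, hpow, hconj⟩ := exists_autEnum_of_generator K hK hg σ₀
  obtain ⟨c, hc⟩ := FaceCensus.exists_conjAut σ₀
  obtain ⟨e, hmul, he⟩ := FaceCensus.exists_enum_of_autEnum Γ σ₀ ε hε
  have hconj' : e conjT = Γ.conj := by rw [FaceCensus.conjT_eq_translate σ₀, ← hc, he, hconj c hc]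
  obtain ⟨R₀, hT₀, -, -⟩ := FaceCensus.exists_face_reads Γ e hmul hconj' σ₀ (r := (1275, 514, 2056))
    (FaceCensus.mem_faces_of_isFaceB Γ (by decide +kernel))
  have hne : InfinitePlace.mk (σ₀.comp ((g ^ (a : ℕ) : ((K : Type) ≃ₐ[ℚ] (K : Type))) : (K : Type) →+* (K : Type))) ≠ InfinitePlace.mk (σ₀.comp ((g ^ (b : ℕ) : ((K : Type) ≃ₐ[ℚ] (K : Type))) : (K : Type) →+* (K : Type))) := by
    rw [Ne, FaceCensus.mk_comp_eq_mk_comp_iff σ₀ hc]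
    rintro (h | h)
    · exact hab.1 (by rw [← hpow a, ← hpow b, h])
    · exact hab.2 (by rw [← hpow a, ← hpow b, ← h, hε, hconj c hc])
  refine ⟨⟨R₀.Φ, _, _, hne⟩, fun k => ?_, rfl, rfl⟩
  have hk := hT₀.2 (e (translate σ₀ (σ₀.comp ((g ^ (k : ℕ) : ((K : Type) ≃ₐ[ℚ] (K : Type))) : (K : Type) →+* (K : Type)))))
  rw [e.symm_apply_apply, mem_pullType, translate_apply_self, he, hpow] at hk
  exact hk.symm.trans (mem_1275_iff k)

/-- **Faces on the type of code `2295` exist (non-vacuity), type `ℤ/16`.**  For `K`, `g`, `σ₀` as above there is a CM type `Φ₀` of `K`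
reading as the exponent set `{0,1,2,4,5,6,7,11}` — `σ₀ ∘ g ^ k ∈ Φ₀ ↔` that condition on `k` (`0 ≤ k < 16`) — and for any two exponents `a, b` at different
places (`b ≠ a`, `b ≠ a + 8`) a rank-four face `(Φ₀; σ₀ ∘ g ^ a, σ₀ ∘ g ^ b)` with exactly these place representatives. [folklore] -/
theorem exists_face_of_generator_2295 (K : CMField) [IsGalois ℚ K] (hK : Module.finrank ℚ (K : Type) = 16)
    {g : ((K : Type) ≃ₐ[ℚ] (K : Type))} (hg : ∀ x, x ∈ Subgroup.zpowers g) (σ₀ : (K : Type) →+* ℂ) (a b : Fin 16)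
    (hab : a ≠ b ∧ Γ.mul Γ.conj a ≠ b) :
    ∃ R : Face K, (∀ k : Fin 16, σ₀.comp ((g ^ (k : ℕ) : ((K : Type) ≃ₐ[ℚ] (K : Type))) : (K : Type) →+* (K : Type)) ∈ R.Φ.1 ↔ k ∈ ({0, 1, 2, 4, 5, 6, 7, 11} : Finset (Fin 16))) ∧
      R.p = σ₀.comp ((g ^ (a : ℕ) : ((K : Type) ≃ₐ[ℚ] (K : Type))) : (K : Type) →+* (K : Type)) ∧ R.p' = σ₀.comp ((g ^ (b : ℕ) : ((K : Type) ≃ₐ[ℚ] (K : Type))) : (K : Type) →+* (K : Type)) := by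
  obtain ⟨ε, hε, hpow, hconj⟩ := exists_autEnum_of_generator K hK hg σ₀
  obtain ⟨c, hc⟩ := FaceCensus.exists_conjAut σ₀
  obtain ⟨e, hmul, he⟩ := FaceCensus.exists_enum_of_autEnum Γ σ₀ ε hε
  have hconj' : e conjT = Γ.conj := by rw [FaceCensus.conjT_eq_translate σ₀, ← hc, he, hconj c hc]
  obtain ⟨R₀, hT₀, -, -⟩ := FaceCensus.exists_face_reads Γ e hmul hconj' σ₀ (r := (2295, 4112, 32896))
    (FaceCensus.mem_faces_of_isFaceB Γ (by decide +kernel))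
  have hne : InfinitePlace.mk (σ₀.comp ((g ^ (a : ℕ) : ((K : Type) ≃ₐ[ℚ] (K : Type))) : (K : Type) →+* (K : Type))) ≠ InfinitePlace.mk (σ₀.comp ((g ^ (b : ℕ) : ((K : Type) ≃ₐ[ℚ] (K : Type))) : (K : Type) →+* (K : Type))) := by
    rw [Ne, FaceCensus.mk_comp_eq_mk_comp_iff σ₀ hc]
    rintro (h | h)
    · exact hab.1 (by rw [← hpow a, ← hpow b, h])
    · exact hab.2 (by rw [← hpow a, ← hpow b, ← h, hε, hconj c hc])
  refine ⟨⟨R₀.Φ, _, _, hne⟩, fun k => ?_, rfl, rfl⟩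
  have hk := hT₀.2 (e (translate σ₀ (σ₀.comp ((g ^ (k : ℕ) : ((K : Type) ≃ₐ[ℚ] (K : Type))) : (K : Type) →+* (K : Type)))))
  rw [e.symm_apply_apply, mem_pullType, translate_apply_self, he, hpow] at hk
  exact hk.symm.trans (mem_2295_iff k)

/-- **Faces on the type of code `2805` exist (non-vacuity), type `ℤ/16`.**  For `K`, `g`, `σ₀` as above there is a CM type `Φ₀` of `K`
reading as the exponent set `{0,2,4,5,6,7,9,11}` — `σ₀ ∘ g ^ k ∈ Φ₀ ↔` that condition on `k` (`0 ≤ k < 16`) — and for any two exponents `a, b` at different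
places (`b ≠ a`, `b ≠ a + 8`) a rank-four face `(Φ₀; σ₀ ∘ g ^ a, σ₀ ∘ g ^ b)` with exactly these place representatives. [folklore] -/
theorem exists_face_of_generator_2805 (K : CMField) [IsGalois ℚ K] (hK : Module.finrank ℚ (K : Type) = 16)
    {g : ((K : Type) ≃ₐ[ℚ] (K : Type))} (hg : ∀ x, x ∈ Subgroup.zpowers g) (σ₀ : (K : Type) →+* ℂ) (a b : Fin 16)
    (hab : a ≠ b ∧ Γ.mul Γ.conj a ≠ b) :
    ∃ R : Face K, (∀ k : Fin 16, σ₀.comp ((g ^ (k : ℕ) : ((K : Type) ≃ₐ[ℚ] (K : Type))) : (K : Type) →+* (K : Type)) ∈ R.Φ.1 ↔ k ∈ ({0, 2, 4, 5, 6, 7, 9, 11} : Finset (Fin 16))) ∧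
      R.p = σ₀.comp ((g ^ (a : ℕ) : ((K : Type) ≃ₐ[ℚ] (K : Type))) : (K : Type) →+* (K : Type)) ∧ R.p' = σ₀.comp ((g ^ (b : ℕ) : ((K : Type) ≃ₐ[ℚ] (K : Type))) : (K : Type) →+* (K : Type)) := by
  obtain ⟨ε, hε, hpow, hconj⟩ := exists_autEnum_of_generator K hK hg σ₀
  obtain ⟨c, hc⟩ := FaceCensus.exists_conjAut σ₀
  obtain ⟨e, hmul, he⟩ := FaceCensus.exists_enum_of_autEnum Γ σ₀ ε hε
  have hconj' : e conjT = Γ.conj := by rw [FaceCensus.conjT_eq_translate σ₀, ← hc, he, hconj c hc]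
  obtain ⟨R₀, hT₀, -, -⟩ := FaceCensus.exists_face_reads Γ e hmul hconj' σ₀ (r := (2805, 16448, 32896))
    (FaceCensus.mem_faces_of_isFaceB Γ (by decide +kernel))
  have hne : InfinitePlace.mk (σ₀.comp ((g ^ (a : ℕ) : ((K : Type) ≃ₐ[ℚ] (K : Type))) : (K : Type) →+* (K : Type))) ≠ InfinitePlace.mk (σ₀.comp ((g ^ (b : ℕ) : ((K : Type) ≃ₐ[ℚ] (K : Type))) : (K : Type) →+* (K : Type))) := by
    rw [Ne, FaceCensus.mk_comp_eq_mk_comp_iff σ₀ hc]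
    rintro (h | h)
    · exact hab.1 (by rw [← hpow a, ← hpow b, h])
    · exact hab.2 (by rw [← hpow a, ← hpow b, ← h, hε, hconj c hc])
  refine ⟨⟨R₀.Φ, _, _, hne⟩, fun k => ?_, rfl, rfl⟩
  have hk := hT₀.2 (e (translate σ₀ (σ₀.comp ((g ^ (k : ℕ) : ((K : Type) ≃ₐ[ℚ] (K : Type))) : (K : Type) →+* (K : Type)))))
  rw [e.symm_apply_apply, mem_pullType, translate_apply_self, he, hpow] at hk
  exact hk.symm.trans (mem_2805_iff k)

/-- **Faces on the type of code `4845` exist (non-vacuity), type `ℤ/16`.**  For `K`, `g`, `σ₀` as above there is a CM type `Φ₀` of `K`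
reading as the exponent set `{0,2,3,5,6,7,9,12}` — `σ₀ ∘ g ^ k ∈ Φ₀ ↔` that condition on `k` (`0 ≤ k < 16`) — and for any two exponents `a, b` at different
places (`b ≠ a`, `b ≠ a + 8`) a rank-four face `(Φ₀; σ₀ ∘ g ^ a, σ₀ ∘ g ^ b)` with exactly these place representatives. [folklore] -/
theorem exists_face_of_generator_4845 (K : CMField) [IsGalois ℚ K] (hK : Module.finrank ℚ (K : Type) = 16)
    {g : ((K : Type) ≃ₐ[ℚ] (K : Type))} (hg : ∀ x, x ∈ Subgroup.zpowers g) (σ₀ : (K : Type) →+* ℂ) (a b : Fin 16)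
    (hab : a ≠ b ∧ Γ.mul Γ.conj a ≠ b) :
    ∃ R : Face K, (∀ k : Fin 16, σ₀.comp ((g ^ (k : ℕ) : ((K : Type) ≃ₐ[ℚ] (K : Type))) : (K : Type) →+* (K : Type)) ∈ R.Φ.1 ↔ k ∈ ({0, 2, 3, 5, 6, 7, 9, 12} : Finset (Fin 16))) ∧
      R.p = σ₀.comp ((g ^ (a : ℕ) : ((K : Type) ≃ₐ[ℚ] (K : Type))) : (K : Type) →+* (K : Type)) ∧ R.p' = σ₀.comp ((g ^ (b : ℕ) : ((K : Type) ≃ₐ[ℚ] (K : Type))) : (K : Type) →+* (K : Type)) := by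
  obtain ⟨ε, hε, hpow, hconj⟩ := exists_autEnum_of_generator K hK hg σ₀
  obtain ⟨c, hc⟩ := FaceCensus.exists_conjAut σ₀
  obtain ⟨e, hmul, he⟩ := FaceCensus.exists_enum_of_autEnum Γ σ₀ ε hε
  have hconj' : e conjT = Γ.conj := by rw [FaceCensus.conjT_eq_translate σ₀, ← hc, he, hconj c hc]
  obtain ⟨R₀, hT₀, -, -⟩ := FaceCensus.exists_face_reads Γ e hmul hconj' σ₀ (r := (4845, 2056, 8224))
    (FaceCensus.mem_faces_of_isFaceB Γ (by decide +kernel))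
  have hne : InfinitePlace.mk (σ₀.comp ((g ^ (a : ℕ) : ((K : Type) ≃ₐ[ℚ] (K : Type))) : (K : Type) →+* (K : Type))) ≠ InfinitePlace.mk (σ₀.comp ((g ^ (b : ℕ) : ((K : Type) ≃ₐ[ℚ] (K : Type))) : (K : Type) →+* (K : Type))) := by
    rw [Ne, FaceCensus.mk_comp_eq_mk_comp_iff σ₀ hc]
    rintro (h | h)
    · exact hab.1 (by rw [← hpow a, ← hpow b, h])
    · exact hab.2 (by rw [← hpow a, ← hpow b, ← h, hε, hconj c hc])
  refine ⟨⟨R₀.Φ, _, _, hne⟩, fun k => ?_, rfl, rfl⟩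
  have hk := hT₀.2 (e (translate σ₀ (σ₀.comp ((g ^ (k : ℕ) : ((K : Type) ≃ₐ[ℚ] (K : Type))) : (K : Type) →+* (K : Type)))))
  rw [e.symm_apply_apply, mem_pullType, translate_apply_self, he, hpow] at hk
  exact hk.symm.trans (mem_4845_iff k)

end Summit.HodgeConjecture.CorCM.HexadecicFaceTransport.Cyclic

end
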